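import Literature.IUT.HodgeArakelov.ThetaSettingHextF2hatCoreAtModelTate
import Literature.IUT.HodgeArakelov.ThetaSettingDeltaCharacteristicAtModelTateUnconditional
import Literature.IUT.HodgeArakelov.MonoThetaProjectiveNaturalSystemAtModelTate
import Literature.AnabelianGeometry.EtaleTheta.Discharge.Sec2RigidityAtModelTate
import Literature.IUT.HodgeArakelov.BadPlaceSettingAtModelTate
import HarnessLib

/-!
# The extension property `hextΔ` at the stage-2 Tate model is a PURE automorphism-extension problem `Û ≤ F̂₂`:
# the displayed conjunct (D) «`γ` carries `Δ^tp_{X̲̲}` onto itself» is DISCHARGED by the tree's (H1) theorem (proof-only)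

S. Mochizuki, *The étale theta function and its Frobenioid-theoretic manifestations* [EtTh], Publ. RIMS **45** (2009)
(refereed), §2, Prop. 2.4 p. 38; §1 p. 12 [cite: MochizukiEtTh2009, Prop 2.4 p.38]; *Inter-universal Teichmüller theory II*, §1,
Example 1.8 (i) (kurims p. 35) «the subgroup `Δ ⊆ Π` […] may be characterized group-theoretically» [claim: Mochizuki2012, status:
disputed]; [AbsTopI] Thm 2.6 (v) p. 22 [cite: MochizukiAbsTopI2012, Thm 2.6 (v) p.22].

Cell `abc-iut`, seat abc-iut-L6-t13 (gen 13; K-L6 row «HEXT-DECIDE@modelχq», sub-row «HEXT-GEOMETRIC-CORE», file 3).  PROOF-ONLY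
companion of this seat's files 1–2 (p502505 `hext_at_iff_exists_gfpAut_extends`, file 2 `hext_at_iff_exists_f2hatAut`) and of
abc-iut-w4-d044's (H1) capstone `ThetaSettingDeltaCharacteristicAtModelTateUnconditional` (p488629,
`deltaX_characteristic_ofDoubleUnderline_modelχq_holds`: at the [IUTchII] §1 setting `S := ofDoubleUnderline C μ …` of ANY
`X̲̲`-choice `C` over `modelχq p i j`, EVERY automorphism of topological groups of `Π^{(S)} = C.Huu` carries `Δ^{(S)}` onto
itself — UNCONDITIONAL, via `Ker (tatePairHom) ≠ ⊥`, elasticity and slimness of `G_{ℚ_p}`).  NO definition, NO instance, NO new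
named fact; every input is consumed BY NAME (`compat_modelχq`, `ThetaSetting.modelχq_sec2Hyps`, `modelχq_exists_cyclotomeMod_family`,
`EtaleThetaDataOfSetting.rootLift` / `ModelTateCarriers.rootLift_mem_rootCocycles`, `EtaleLevels.eta0_mem`,
`ThetaSetting.mem_deltaX_ofDoubleUnderline_iff`).

WHAT THIS FILE PROVES (EVERY prime `p`, EVERY `i j`, EVERY étale-theta datum `E` over `modelχq p i j`, EVERY `X̲̲`-choice `C`;
the [IUTchII] §1 side hypotheses «`l` prime, `p ≠ 2`, `p ≠ l`, `ℚ_p ∋ ζ_{4l}`» are the ONLY extra arguments — they are needed to FORM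
the setting `S`, and at the datum of record (`4·l ∣ p − 1`) they are theorems: §3).
* §1 `right_coe_apply_eq_one_of_right_eq_one` — **(D) IS A THEOREM**: every bi-continuous automorphism `γ` of `Π^tp_{X̲̲} = C.Huu`
  maps `{h | h.right = 1} = Δ^tp_X ∩ Π^tp_{X̲̲} = Δ^tp_{X̲̲}` into itself (the side data `μ`, `η` of `S` are supplied from the tree:
  a cyclotome family and the root cocycle `rootLift`); `right_apply_inl_eq_one` / `right_symm_apply_inl_eq_one` — the two (D)
  clauses of file 2's `hext_at_iff_exists_f2hatAut`, for `γ` and `γ⁻¹`.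
* §2 ★ `hext_at_iff_exists_f2hatAut_pure` — **`hextΔ(γ) ⟺ (E)` ALONE**:
    `hextΔ(γ) ⟺ ∃ Φ̂ : F̂₂ ≃ₜ* F̂₂, Φ̂ (pr₁ d) = pr₁ ((γ (inl d)).left)` for all `d ∈ dUU l`,
  i.e. «the completed geometric part of `γ` (an automorphism of the dense subgroup `pr₁(dUU l)` of the open subgroup
  `Û = ĥ_l⁻¹{x = z = 0} ≤ F̂₂`, index `l²`) is the restriction of a topological automorphism of the free profinite group `F̂₂`»;
  `hext_at_iff_exists_f2hatAut_pure_of_eq` = the same at the carrier of record `Huuχq p i j l hl`.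
* §3 `hext_at_iff_exists_f2hatAut_record` — at `4·l ∣ p − 1` (the datum of record; `p ≠ 2`, `p ≠ l`, `ζ_{4l} ∈ ℚ_p` are then the
  tree's `ModelTateCarriers.ne_two_of_four_mul_dvd_pred`, `…ne_of_four_mul_dvd_pred`, `…exists_isPrimitiveRoot_K_modelχq`).
CONSEQUENCE FOR THE K-L6 CELL (honest words): the census cell «`hextΔ` UNDECIDED-AT-MODEL» is now LITERALLY and ONLY the extension
problem (E) in `Aut_top(F̂₂)`; the (D) side carries NO residual (the lead's ruling §F v1.19eh (B) «keep (D) a displayed conjunct, NOT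
a tree theorem» is superseded BY NAME by p488629 — the conjunct stays displayed in file 2 and is discharged here).  Refuter / decider
targets: automorphisms of `Û` arising from some `γ` (abc-iut-w5-d125's (φ, e)-constructor) that do / do not extend to `F̂₂`.
Neither direction of `hextΔ` is claimed.

HONEST LABEL. `modelχq` is a SEMI-SYNTHETIC model of the typed [EtTh] §1 interface (not the tempered `π₁` of a curve): statements
about OUR model and OUR typed binder only; nothing of [EtTh] / [IUTchII] (claim key `Mochizuki2012`, DISPUTED, D-0012) is asserted;
no side is taken on [IUTchIII] Cor. 3.12; typed ≠ proved; nothing here bears on whether abc is proved or refuted.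
bears_on: LADDER-ABC:A2.L-K (K-L6 «HEXT-DECIDE@modelχq») → LADDER-FRONTIER F-A2 (M·L6) → rung 0 `Summit.ABC`.
-/

set_option autoImplicit false

noncomputable section

namespace Literature.AnabelianGeometry.EtaleTheta.SettingModel

open Literature.AnabelianGeometry.SemiGraphs
open Literature.IUT.HodgeArakelov
open Function
open _root_.Topology

variable {p : ℕ} [Fact p.Prime] {i j : ℤ} {hj : Even j} {E : (ThetaSetting.modelχq p i j hj).EtaleThetaData} {l : ℕ}
  (C : E.DoubleUnderline l) {l' : ℕ+}
  (hinl : ∀ d ∈ dUU l', (SemidirectProduct.inl d : PiTpχq p i j) ∈ C.Huu)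
  (hinr : ∀ σ : GQp p, (SemidirectProduct.inr σ : PiTpχq p i j) ∈ C.Huu)
  (hleft : ∀ h ∈ C.Huu, (h : PiTpχq p i j).left ∈ dUU l')
  (hl : l.Prime) (hp2 : p ≠ 2) (hpl : p ≠ l) (hζ : ∃ ζ : (ThetaSetting.modelχq p i j hj).K, IsPrimitiveRoot ζ (4 * l))

/-! ## §1. (D) is a theorem: every automorphism of `Π^tp_{X̲̲}` preserves `Δ^tp_{X̲̲} = {h | h.right = 1}` -/

include hl hp2 hpl hζ in
/-- **(D) AT THE MODEL, from the tree's (H1)**: for every `X̲̲`-choice `C` over `modelχq p i j` and every automorphism `γ` of the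
topological group `Π^tp_{X̲̲} = C.Huu`, `h.right = 1 ⟹ (γ h).right = 1` — i.e. `γ(Δ^tp_{X̲̲}) ⊆ Δ^tp_{X̲̲}` (p488629
`deltaX_characteristic_ofDoubleUnderline_modelχq_holds` at the [IUTchII] §1 setting of `C`, whose side data are supplied from the
tree: `Compat`/`Sec2Hyps` of the model, a cyclotome family, the root cocycle `rootLift`).
[claim: Mochizuki2012, status: disputed] (IUTchII §1 Ex 1.8 (i), kurims p.35) [cite: MochizukiAbsTopI2012, Thm 2.6 (v) p.22] -/
theorem right_coe_apply_eq_one_of_right_eq_one (γ : ↥C.Huu ≃ₜ* ↥C.Huu) (h : C.Huu) (hh : (h : PiTpχq p i j).right = 1) :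
    ((γ h : C.Huu) : PiTpχq p i j).right = 1 := by
  classical
  -- the [IUTchII] §1 side data of `X̲̲` at the model
  have hC : (ThetaSetting.modelχq p i j hj).Compat := compat_modelχq p i j hj
  have hS : (ThetaSetting.modelχq p i j hj).Sec2Hyps := ThetaSetting.modelχq_sec2Hyps p i j hj
  obtain ⟨mods, -⟩ := modelχq_exists_cyclotomeMod_family p i j hj hl.pos
  have hf := ModelTateCarriers.rootLift_mem_rootCocycles C hC
  have hη := EtaleLevels.eta0_mem C hC hS mods (EtaleThetaDataOfSetting.rootLift C) hf 1
  -- (H1) at the setting `S := ofDoubleUnderline C (mods 1) …`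
  have H := deltaX_characteristic_ofDoubleUnderline_modelχq_holds p i j hj C (mods 1) hC hS hl hp2 hpl hζ hη γ
  have hmem : (show (ThetaSetting.ofDoubleUnderline C (mods 1) hC hS hl hp2 hpl hζ hη).PiX from h) ∈
      (ThetaSetting.ofDoubleUnderline C (mods 1) hC hS hl hp2 hpl hζ hη).DeltaX :=
    (ThetaSetting.mem_deltaX_ofDoubleUnderline_iff C (mods 1) hC hS hl hp2 hpl hζ hη _).2 ((mem_deltaTempχq_iff p i j _).2 hh)
  have h2 : (show (ThetaSetting.ofDoubleUnderline C (mods 1) hC hS hl hp2 hpl hζ hη).PiX from γ h) ∈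
      (ThetaSetting.ofDoubleUnderline C (mods 1) hC hS hl hp2 hpl hζ hη).DeltaX := by
    rw [← H]
    exact ⟨_, hmem, rfl⟩
  exact (mem_deltaTempχq_iff p i j _).1
    ((ThetaSetting.mem_deltaX_ofDoubleUnderline_iff C (mods 1) hC hS hl hp2 hpl hζ hη _).1 h2)

include hl hp2 hpl hζ in
/-- The first (D) clause of file 2: `(γ (inl d)).right = 1` for `d ∈ dUU l`.
[claim: Mochizuki2012, status: disputed] (IUTchII §1 Ex 1.8 (i), kurims p.35) -/
theorem right_apply_inl_eq_one (γ : ↥C.Huu ≃ₜ* ↥C.Huu) (d : Gfp) (hd : d ∈ dUU l') :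
    (((γ ⟨SemidirectProduct.inl d, hinl d hd⟩ : C.Huu) : PiTpχq p i j)).right = 1 :=
  right_coe_apply_eq_one_of_right_eq_one C hl hp2 hpl hζ γ _ (SemidirectProduct.right_inl d)

include hl hp2 hpl hζ in
/-- The second (D) clause of file 2: `(γ⁻¹ (inl d)).right = 1` for `d ∈ dUU l`.
[claim: Mochizuki2012, status: disputed] (IUTchII §1 Ex 1.8 (i), kurims p.35) -/
theorem right_symm_apply_inl_eq_one (γ : ↥C.Huu ≃ₜ* ↥C.Huu) (d : Gfp) (hd : d ∈ dUU l') :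
    (((γ.symm ⟨SemidirectProduct.inl d, hinl d hd⟩ : C.Huu) : PiTpχq p i j)).right = 1 :=
  right_coe_apply_eq_one_of_right_eq_one C hl hp2 hpl hζ γ.symm _ (SemidirectProduct.right_inl d)

/-! ## §2. `hextΔ(γ)` ⟺ (E) alone -/

include hinl hinr hleft hl hp2 hpl hζ in
/-- ★ **`hextΔ(γ)` IS EXACTLY THE F̂₂-EXTENSION PROBLEM (E).**  At an `X̲̲`-choice with `Π^tp_{X̲̲} = dUU l ⋊ G_{ℚ_p}` over the
stage-2 Tate model (and the [IUTchII] §1 side hypotheses `l` prime, `p ≠ 2`, `p ≠ l`, `ζ_{4l} ∈ ℚ_p`), a bi-continuous automorphism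
`γ` of `Π^tp_{X̲̲}` extends to a `Δ^tp_X`-stabilising bi-continuous automorphism of `Π^tp_X` IF AND ONLY IF some topological
automorphism `Φ̂` of the free profinite group `F̂₂` satisfies `Φ̂ (pr₁ d) = pr₁ ((γ (inl d)).left)` for all `d ∈ dUU l`
(file 2's (D) clauses discharged by §1).  Neither direction of `hextΔ` is claimed. [cite: MochizukiEtTh2009, Prop 2.4 p.38] -/
theorem hext_at_iff_exists_f2hatAut_pure (γ : ↥C.Huu ≃ₜ* ↥C.Huu) :
    (∃ Γ : PiTpχq p i j ≃ₜ* PiTpχq p i j,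
      (∀ h : C.Huu, Γ (h : PiTpχq p i j) = ((γ h : C.Huu) : PiTpχq p i j)) ∧
        (curveχq p i j).DeltaTemp.map Γ.toMulEquiv.toMonoidHom = (curveχq p i j).DeltaTemp) ↔
    ∃ Φh : F₂hatT ≃ₜ* F₂hatT, ∀ (d : Gfp) (hd : d ∈ dUU l'),
      Φh (gfpFst d) = gfpFst (((γ ⟨SemidirectProduct.inl d, hinl d hd⟩ : C.Huu) : PiTpχq p i j)).left := by
  rw [hext_at_iff_exists_f2hatAut C hinl hinr hleft γ]
  exact ⟨fun h => h.2.2, fun h => ⟨right_apply_inl_eq_one C hinl hl hp2 hpl hζ γ,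
    right_symm_apply_inl_eq_one C hinl hl hp2 hpl hζ γ, h⟩⟩

include hl hp2 hpl hζ in
/-- **(E) alone, AT THE CARRIER OF RECORD** `Π^tp_{X̲̲} = Huuχq p i j l hl`: for every `X̲̲`-choice `C` over `modelχq p i j` with
`C.Huu = Huuχq p i j l hl`, `hextΔ(γ) ⟺ ∃ Φ̂ : F̂₂ ≃ₜ* F̂₂` extending `pr₁ ∘ γ ∘ inl` on `dUU l`. [cite: MochizukiEtTh2009, Prop 2.4 p.38] -/
theorem hext_at_iff_exists_f2hatAut_pure_of_eq (l' : ℕ+) (hl' : Odd (l' : ℕ)) (hCH : C.Huu = Huuχq p i j l' hl')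
    (γ : ↥C.Huu ≃ₜ* ↥C.Huu) :
    (∃ Γ : PiTpχq p i j ≃ₜ* PiTpχq p i j,
      (∀ h : C.Huu, Γ (h : PiTpχq p i j) = ((γ h : C.Huu) : PiTpχq p i j)) ∧
        (curveχq p i j).DeltaTemp.map Γ.toMulEquiv.toMonoidHom = (curveχq p i j).DeltaTemp) ↔
    ∃ Φh : F₂hatT ≃ₜ* F₂hatT, ∀ (d : Gfp) (hd : d ∈ dUU l'),
      Φh (gfpFst d) =
        gfpFst (((γ ⟨SemidirectProduct.inl d, hCH ▸ (inl_mem_Huuχq_iff p i j l' hl' d).2 hd⟩ : C.Huu) : PiTpχq p i j)).left :=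
  hext_at_iff_exists_f2hatAut_pure C (fun d hd => hCH ▸ (inl_mem_Huuχq_iff p i j l' hl' d).2 hd)
    (fun σ => hCH ▸ inr_mem_Huuχq p i j l' hl' σ)
    (fun h hh => ((mem_Huuχq_iff p i j l' hl' h).1 (hCH ▸ hh)).1 |> fun hx =>
      (mem_dUU_iff l' h.left).2 ⟨hx, ((mem_Huuχq_iff p i j l' hl' h).1 (hCH ▸ hh)).2⟩) hl hp2 hpl hζ γ

/-! ## §3. At the datum of record `4·l ∣ p − 1` -/

include hinl hinr hleft in
/-- **(E) alone AT THE DATUM OF RECORD**: for `l` prime with `4·l ∣ p − 1` (so `p ≠ 2`, `p ≠ l`, `ζ_{4l} ∈ ℚ_p` — the tree's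
`ne_two_of_four_mul_dvd_pred`, `ne_of_four_mul_dvd_pred`, `exists_isPrimitiveRoot_K_modelχq`), every `i j`, every `X̲̲`-choice:
`hextΔ(γ) ⟺ ∃ Φ̂ : F̂₂ ≃ₜ* F̂₂` extending `pr₁ ∘ γ ∘ inl` on `dUU l`. [cite: MochizukiEtTh2009, Prop 2.4 p.38] -/
theorem hext_at_iff_exists_f2hatAut_record (hlp : l.Prime) (hdvd : 4 * l ∣ p - 1) (γ : ↥C.Huu ≃ₜ* ↥C.Huu) :
    (∃ Γ : PiTpχq p i j ≃ₜ* PiTpχq p i j,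
      (∀ h : C.Huu, Γ (h : PiTpχq p i j) = ((γ h : C.Huu) : PiTpχq p i j)) ∧
        (curveχq p i j).DeltaTemp.map Γ.toMulEquiv.toMonoidHom = (curveχq p i j).DeltaTemp) ↔
    ∃ Φh : F₂hatT ≃ₜ* F₂hatT, ∀ (d : Gfp) (hd : d ∈ dUU l'),
      Φh (gfpFst d) = gfpFst (((γ ⟨SemidirectProduct.inl d, hinl d hd⟩ : C.Huu) : PiTpχq p i j)).left :=
  hext_at_iff_exists_f2hatAut_pure C hinl hinr hleft hlp (ModelTateCarriers.ne_two_of_four_mul_dvd_pred p hlp.pos hdvd)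
    (ModelTateCarriers.ne_of_four_mul_dvd_pred p hlp.pos hdvd)
    (ModelTateCarriers.exists_isPrimitiveRoot_K_modelχq p i j hj hlp.pos hdvd) γ

end Literature.AnabelianGeometry.EtaleTheta.SettingModel

end
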